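import Literature.Computability.MetaComplexity.SmolenskyCorrelation
import Literature.Computability.Complexity.CircuitSubstitution
import Literature.Computability.Complexity.Randomized
import HarnessLib

/-!
# Razborov–Smolensky for relation (search) problems with random advice

The standard reduction of an average-case lower bound for RELATION problems against
`AC⁰[p]/rpoly` circuits (a tuple of single-output circuits `C_1, …, C_m` over
`accBasis p = {¬, ∧ₖ, ∨ₖ, MOD_{p,k}}` reading the input followed by `r` shared uniformly random
bits) to a statement about LOW-DEGREE POLYNOMIAL MAPS over `𝔽_p`, as used by
Watts–Kothari–Schaeffer–Tal 2019 and Grewal–Kumar 2024: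

1. (random advice) "an `AC⁰/rpoly` circuit defines a distribution over `AC⁰` circuits and we can
   simply pick the one that does the best against our input distribution" (WKST 2019, proof of
   Thm. 15, first paragraph) — here, dually, as an averaging (double-counting) step producing an
   input on which the random string helps little (`exists_mem_uniformProb_le`);
2. (hard-wiring) for a fixed random string, and for inputs ranging over a sub-cube given by a
   substitution of variables and constants `e : {0,1}ᵏ → {0,1}ⁿ` (the promise inputs of the
   problem written in free Boolean parameters), the circuits become circuits on `k` inputs over the
   same basis, `acDepth + 1`, `size + 2` (`Circuit.exists_subst`, Vollmer 1999 §1.2);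
3. (polynomial method) all `m` output wires are simultaneously polynomial functions of degree
   `≤ ((p-1)ℓ)^{d+1}` off ONE exceptional set `E` with `|E|·p^ℓ ≤ Σ_v (size C_v + 2)·2ᵏ`
   (`razborov_smolensky_multi`; Smolensky 1987, Grewal–Kumar 2024 Prop. 4.1 / §5.3–5.4).

Main statements (`W u z` is an arbitrary "success" predicate of the parameter `u ∈ {0,1}ᵏ` and
the output tuple `z ∈ {0,1}ᵐ`; `T` a non-empty set of promised parameters):

* `exists_lowDeg_map_of_circuits` — steps 2+3 for deterministic circuits;
* `card_filter_success_le` — for deterministic circuits: if every degree-`≤ ((p-1)ℓ)^{d+1}`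
  polynomial map succeeds on at most `B` parameters of `T`, the circuits succeed on at most
  `B + Σ_v (size C_v + 2)·2ᵏ/p^ℓ` parameters of `T`;
* `sum_card_success_le` — with `r` random bits: the number of pairs (parameter, random string)
  on which the circuits succeed is at most `2ʳ·(B + Σ_v (size C_v + 2)·2ᵏ/p^ℓ)`;
* `exists_mem_uniformProb_le` — hence some promised parameter `u ∈ T` has success probability
  (over the random string, `uniformProb`) at most `(B + Σ_v (size C_v + 2)·2ᵏ/p^ℓ)/|T|`;
  `exists_uniformProb_le` is the case `T = {0,1}ᵏ`.

Deliberately NOT here: the choice of `ℓ` against a size bound (the user picks `ℓ`), polynomial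
maps on the ambient `n` variables (lift with `Smolensky.comp_subst_mem_lowDeg`), `GC⁰(k)` gates.

## References

* A. Bene Watts, R. Kothari, L. Schaeffer, A. Tal, *Exponential separation between shallow quantum
  circuits and unbounded fan-in shallow classical circuits*, STOC 2019, arXiv:1906.08890, proof of
  Thm. 15 (random advice), §6 (polynomial method for search problems) [WattsEtAl2019].
* S. Grewal, V. M. Kumar, *Improved circuit lower bounds and quantum-classical separations*,
  arXiv:2408.16406 (2024), Prop. 4.1, §5.3–5.4 [GrewalKumar2024].
* R. Smolensky, *Algebraic methods in the theory of lower bounds for Boolean circuit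
  complexity*, STOC 1987 [Smolensky1987].
* H. Vollmer, *Introduction to Circuit Complexity*, Springer 1999, §1.2 [Vollmer1999].
-/

noncomputable section

namespace Literature.Computability.MetaComplexity

open Finset Literature.Computability.Complexity

namespace Smolensky

open scoped Classical

variable {p : ℕ} [Fact p.Prime]

/-! ### Deterministic circuits on a sub-cube of inputs -/

/-- **Hard-wiring + multi-output Razborov–Smolensky.** Let `e : {0,1}ᵏ → {0,1}ⁿ` be a
substitution of variables and constants (every coordinate of `e u` is a constant or some `u_j`)
and `C_1, …, C_m` circuits over `accBasis p` on `n` inputs of `acDepth ≤ d`; let `ℓ ≥ 1`. Then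
there are polynomial functions `P_v : {0,1}ᵏ → 𝔽_p` of degree `≤ ((p-1)ℓ)^{d+1}` and ONE set
`E ⊆ {0,1}ᵏ` with `|E|·p^ℓ ≤ (Σ_v (size C_v + 2))·2ᵏ` such that off `E` every output wire is
read off its polynomial: `C_v(e u) = [P_v(u) = 1]` (Vollmer 1999 §1.2 for the substitution;
Smolensky 1987 / Grewal–Kumar 2024 Prop. 4.1 for the approximation).
[cite: GrewalKumar2024, Prop. 4.1 and §5.3] -/
theorem exists_lowDeg_map_of_circuits {k n m d ℓ : ℕ} (hℓ : 1 ≤ ℓ)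
    (e : (Fin k → Bool) → (Fin n → Bool))
    (he : ∀ i, (∃ b, ∀ u, e u i = b) ∨ (∃ j, ∀ u, e u i = u j))
    (C : Fin m → Circuit (Fin n)) (hC : ∀ v, (C v).IsOver (accBasis p))
    (hd : ∀ v, (C v).acDepth ≤ d) :
    ∃ (P : Fin m → CubeFn (ZMod p) k) (E : Finset (Fin k → Bool)),
      (∀ v, P v ∈ lowDeg (ZMod p) k (((p - 1) * ℓ) ^ (d + 1))) ∧
        E.card * p ^ ℓ ≤ (∑ v, ((C v).size + 2)) * 2 ^ k ∧
        ∀ u, u ∉ E → ∀ v, (C v).eval (e u) = decide (P v u = 1) := by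
  have hp := (Fact.out : p.Prime)
  -- hard-wire the substitution into each circuit
  have hsub : ∀ v, ∃ C' : Circuit (Fin k), C'.IsOver (accBasis p) ∧ C'.acDepth ≤ d + 1 ∧
      C'.size ≤ (C v).size + 2 ∧ ∀ u, C'.eval u = (C v).eval (e u) := fun v => by
    obtain ⟨C', h1, h2, h3, h4⟩ :=
      Circuit.exists_subst (acBasis_subset_accBasis p) (C v) (hC v) e he
    exact ⟨C', h1, h2.trans (by have := hd v; omega), h3, h4⟩
  choose C' hC' hd' hs' hev' using hsub
  obtain ⟨P, E, hP, hE, hPE⟩ := razborov_smolensky_multi C' hC' hd' hℓ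
  refine ⟨P, E, hP, hE.trans ?_, fun u hu v => ?_⟩
  · exact Nat.mul_le_mul_right _ (sum_le_sum fun v _ => hs' v)
  · rw [← hev' v u, hPE u hu v]
    have h01 : (0 : ZMod p) ≠ 1 := zero_ne_one
    cases (C' v).eval u
    · rw [bit_false, decide_eq_false h01]
    · rw [bit_true, decide_eq_true rfl]

/-- **Deterministic circuits versus polynomial maps on a promise.** In the situation of
`exists_lowDeg_map_of_circuits`, let `W u z` be any success predicate (parameter `u ∈ {0,1}ᵏ`,
output tuple `z ∈ {0,1}ᵐ`) and `T ⊆ {0,1}ᵏ` a set of promised parameters. If every polynomial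
map of degree `≤ ((p-1)ℓ)^{d+1}` (outputs read as `[P_v(u) = 1]`) succeeds on at most `B`
parameters of `T`, then the circuits succeed on at most `B + (Σ_v (size C_v + 2))·2ᵏ/p^ℓ`
parameters of `T` (stated cleared of denominators).
[cite: GrewalKumar2024, Prop. 4.1 and §5.3] -/
theorem card_filter_success_le {k n m d ℓ : ℕ} (hℓ : 1 ≤ ℓ)
    (e : (Fin k → Bool) → (Fin n → Bool))
    (he : ∀ i, (∃ b, ∀ u, e u i = b) ∨ (∃ j, ∀ u, e u i = u j))
    (C : Fin m → Circuit (Fin n)) (hC : ∀ v, (C v).IsOver (accBasis p))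
    (hd : ∀ v, (C v).acDepth ≤ d) (W : (Fin k → Bool) → (Fin m → Bool) → Prop)
    (T : Finset (Fin k → Bool)) {B : ℕ}
    (hB : ∀ P : Fin m → CubeFn (ZMod p) k,
      (∀ v, P v ∈ lowDeg (ZMod p) k (((p - 1) * ℓ) ^ (d + 1))) →
        (T.filter fun u => W u fun v => decide (P v u = 1)).card ≤ B) :
    (T.filter fun u => W u fun v => (C v).eval (e u)).card * p ^ ℓ ≤
      B * p ^ ℓ + (∑ v, ((C v).size + 2)) * 2 ^ k := by
  obtain ⟨P, E, hP, hE, hPE⟩ := exists_lowDeg_map_of_circuits hℓ e he C hC hd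
  have hsplit : (T.filter fun u => W u fun v => (C v).eval (e u)) ⊆
      (T.filter fun u => W u fun v => decide (P v u = 1)) ∪ E := by
    intro u hu
    rw [mem_filter] at hu
    rw [mem_union, mem_filter]
    by_cases huE : u ∈ E
    · exact Or.inr huE
    · refine Or.inl ⟨hu.1, ?_⟩
      have h := hu.2
      have hfun : (fun v => (C v).eval (e u)) = fun v => decide (P v u = 1) :=
        funext fun v => hPE u huE v
      rwa [hfun] at h
  calc (T.filter fun u => W u fun v => (C v).eval (e u)).card * p ^ ℓ
      ≤ ((T.filter fun u => W u fun v => decide (P v u = 1)).card + E.card) * p ^ ℓ := by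
        refine Nat.mul_le_mul_right _ ((card_le_card hsplit).trans (card_union_le _ _))
    _ = (T.filter fun u => W u fun v => decide (P v u = 1)).card * p ^ ℓ + E.card * p ^ ℓ := by
        ring
    _ ≤ B * p ^ ℓ + (∑ v, ((C v).size + 2)) * 2 ^ k :=
        add_le_add (Nat.mul_le_mul_right _ (hB P hP)) hE

/-! ### Random advice: `r` shared random bits appended to the input -/

/-- Appending a fixed string of `r` bits to a substitution of variables and constants is again a
substitution of variables and constants. [folklore] -/
private theorem subst_append {k n r : ℕ} (e : (Fin k → Bool) → (Fin n → Bool))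
    (he : ∀ i, (∃ b, ∀ u, e u i = b) ∨ (∃ j, ∀ u, e u i = u j)) (ρ : Fin r → Bool) :
    ∀ i, (∃ b, ∀ u, Fin.append (e u) ρ i = b) ∨ (∃ j, ∀ u, Fin.append (e u) ρ i = u j) := by
  intro i
  induction i using Fin.addCases with
  | left i' =>
    rcases he i' with ⟨b, hb⟩ | ⟨j, hj⟩
    · exact Or.inl ⟨b, fun u => by rw [Fin.append_left, hb u]⟩
    · exact Or.inr ⟨j, fun u => by rw [Fin.append_left, hj u]⟩
  | right j => exact Or.inl ⟨ρ j, fun u => by rw [Fin.append_right]⟩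

/-- **Counting form with random advice.** Circuits `C_1, …, C_m` over `accBasis p` on `n + r`
inputs (`acDepth ≤ d`) are run on `e u` followed by a random string `ρ ∈ {0,1}ʳ`. If every
polynomial map `{0,1}ᵏ → 𝔽_pᵐ` of degree `≤ ((p-1)ℓ)^{d+1}` succeeds (in the sense of `W`) on at
most `B` promised parameters `u ∈ T`, then the number of pairs `(u, ρ) ∈ T × {0,1}ʳ` on which the
circuits succeed is at most `2ʳ·(B + (Σ_v (size C_v + 2))·2ᵏ/p^ℓ)` — for each FIXED `ρ` the
circuits are deterministic (WKST 2019, proof of Thm. 15: "an `AC⁰/rpoly` circuit defines a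
distribution over `AC⁰` circuits") and `card_filter_success_le` applies.
[cite: WattsEtAl2019, proof of Theorem 15] -/
theorem sum_card_success_le {k n r m d ℓ : ℕ} (hℓ : 1 ≤ ℓ)
    (e : (Fin k → Bool) → (Fin n → Bool))
    (he : ∀ i, (∃ b, ∀ u, e u i = b) ∨ (∃ j, ∀ u, e u i = u j))
    (C : Fin m → Circuit (Fin (n + r))) (hC : ∀ v, (C v).IsOver (accBasis p))
    (hd : ∀ v, (C v).acDepth ≤ d) (W : (Fin k → Bool) → (Fin m → Bool) → Prop)
    (T : Finset (Fin k → Bool)) {B : ℕ}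
    (hB : ∀ P : Fin m → CubeFn (ZMod p) k,
      (∀ v, P v ∈ lowDeg (ZMod p) k (((p - 1) * ℓ) ^ (d + 1))) →
        (T.filter fun u => W u fun v => decide (P v u = 1)).card ≤ B) :
    (∑ ρ : Fin r → Bool,
        (T.filter fun u => W u fun v => (C v).eval (Fin.append (e u) ρ)).card) * p ^ ℓ ≤
      2 ^ r * (B * p ^ ℓ + (∑ v, ((C v).size + 2)) * 2 ^ k) := by
  rw [sum_mul]
  calc ∑ ρ : Fin r → Bool,
        (T.filter fun u => W u fun v => (C v).eval (Fin.append (e u) ρ)).card * p ^ ℓ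
      ≤ ∑ _ρ : Fin r → Bool, (B * p ^ ℓ + (∑ v, ((C v).size + 2)) * 2 ^ k) :=
        sum_le_sum fun ρ _ =>
          card_filter_success_le hℓ (fun u => Fin.append (e u) ρ) (subst_append e he ρ)
            C hC hd W T hB
    _ = 2 ^ r * (B * p ^ ℓ + (∑ v, ((C v).size + 2)) * 2 ^ k) := by
        rw [sum_const, card_univ, Fintype.card_fun, Fintype.card_bool, Fintype.card_fin,
          smul_eq_mul]

/-! ### From counts to `uniformProb` -/

/-- Bit strings of length `r` as vectors versus functions `Fin r → Bool`: the count of vectors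
`ρ` whose list satisfies a property of `i ↦ ρ.getD i false` is the count of functions.
[folklore] -/
private theorem card_filter_vector_eq {r : ℕ} (S : (Fin r → Bool) → Prop) :
    (univ.filter fun ρ : List.Vector Bool r => S fun i => ρ.toList.getD i false).card =
      (univ.filter fun f : Fin r → Bool => S f).card := by
  refine card_bij (fun ρ _ => fun i => ρ.toList.getD i false) (fun ρ hρ => ?_)
    (fun ρ₁ h₁ ρ₂ h₂ h => ?_) (fun f hf => ?_)
  · simpa only [mem_filter, mem_univ, true_and] using hρ
  · apply List.Vector.ext
    intro i
    have hi := congrFun h i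
    rw [List.getD_eq_getElem _ _ (by rw [List.Vector.toList_length]; exact i.isLt),
      List.getD_eq_getElem _ _ (by rw [List.Vector.toList_length]; exact i.isLt)] at hi
    rw [List.Vector.get_eq_get_toList, List.Vector.get_eq_get_toList]
    exact hi
  · refine ⟨List.Vector.ofFn f, ?_, ?_⟩
    · have h : (fun i : Fin r => (List.Vector.ofFn f).toList.getD i false) = f := by
        funext i
        rw [List.Vector.toList_ofFn,
          List.getD_eq_getElem _ _ (by rw [List.length_ofFn]; exact i.isLt), List.getElem_ofFn]
      simpa only [mem_filter, mem_univ, true_and, h] using hf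
    · funext i
      rw [List.Vector.toList_ofFn,
        List.getD_eq_getElem _ _ (by rw [List.length_ofFn]; exact i.isLt), List.getElem_ofFn]

/-- `uniformProb` of an event depending on the first `r` bits, as a count of functions
`Fin r → Bool`. [folklore] -/
private theorem uniformProb_eq_card {r : ℕ} (S : (Fin r → Bool) → Prop) :
    uniformProb r {ρ | S fun i => ρ.getD i false} =
      ((univ.filter fun f : Fin r → Bool => S f).card : ℝ) / 2 ^ r := by
  unfold uniformProb
  rw [← card_filter_vector_eq S]
  rfl

/-- **Razborov–Smolensky for relation problems against `AC⁰[p]/rpoly` (probability form, with a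
promise).** Let `e : {0,1}ᵏ → {0,1}ⁿ` be a substitution of variables and constants,
`T ⊆ {0,1}ᵏ` a non-empty set of promised parameters, `C_1, …, C_m` circuits over `accBasis p`
on `n + r` inputs of `acDepth ≤ d` (run on `e u` followed by `r` uniform random bits), `ℓ ≥ 1`,
and `W` any success predicate. If every polynomial map `{0,1}ᵏ → 𝔽_pᵐ` of degree
`≤ ((p-1)ℓ)^{d+1}` succeeds on at most `B` parameters of `T`, then SOME promised parameter
`u ∈ T` has success probability at most `(B + (Σ_v (size C_v + 2))·2ᵏ/p^ℓ)/|T|`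
(WKST 2019, proof of Thm. 15, random advice removed by averaging; Grewal–Kumar 2024, §5.3–5.4).
[cite: WattsEtAl2019, proof of Theorem 15] -/
theorem exists_mem_uniformProb_le {k n r m d ℓ : ℕ} (hℓ : 1 ≤ ℓ)
    (e : (Fin k → Bool) → (Fin n → Bool))
    (he : ∀ i, (∃ b, ∀ u, e u i = b) ∨ (∃ j, ∀ u, e u i = u j))
    (C : Fin m → Circuit (Fin (n + r))) (hC : ∀ v, (C v).IsOver (accBasis p))
    (hd : ∀ v, (C v).acDepth ≤ d) (W : (Fin k → Bool) → (Fin m → Bool) → Prop)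
    {T : Finset (Fin k → Bool)} (hT : T.Nonempty) {B : ℝ}
    (hB : ∀ P : Fin m → CubeFn (ZMod p) k,
      (∀ v, P v ∈ lowDeg (ZMod p) k (((p - 1) * ℓ) ^ (d + 1))) →
        ((T.filter fun u => W u fun v => decide (P v u = 1)).card : ℝ) ≤ B) :
    ∃ u ∈ T,
      uniformProb r {ρ | W u fun v => (C v).eval (Fin.append (e u) fun i => ρ.getD i false)} ≤
        (B + (∑ v, ((C v).size + 2 : ℝ)) * 2 ^ k / (p : ℝ) ^ ℓ) / T.card := by
  have hp := (Fact.out : p.Prime)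
  have hpℓ : (0 : ℝ) < (p : ℝ) ^ ℓ := by
    have : (0 : ℝ) < p := by exact_mod_cast hp.pos
    positivity
  -- integer part of the real bound `B` (which is `≥ 0`: test the zero map)
  have hB0 : 0 ≤ B :=
    (Nat.cast_nonneg _).trans (hB (fun _ => 0) fun _ => Submodule.zero_mem _)
  have hBn : ∀ P : Fin m → CubeFn (ZMod p) k,
      (∀ v, P v ∈ lowDeg (ZMod p) k (((p - 1) * ℓ) ^ (d + 1))) →
        (T.filter fun u => W u fun v => decide (P v u = 1)).card ≤ ⌊B⌋₊ :=
    fun P hP => Nat.le_floor (hB P hP)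
  have hfloor : (⌊B⌋₊ : ℝ) ≤ B := Nat.floor_le hB0
  -- the success indicator as a function of (parameter, random function)
  set S : (Fin k → Bool) → (Fin r → Bool) → Prop :=
    fun u ρ => W u fun v => (C v).eval (Fin.append (e u) ρ) with hS
  -- double counting: Σ_u #{ρ} = Σ_ρ #{u}
  have hswap : ∑ u ∈ T, (univ.filter fun ρ : Fin r → Bool => S u ρ).card =
      ∑ ρ : Fin r → Bool, (T.filter fun u => S u ρ).card := by
    simp_rw [card_filter]
    exact sum_comm
  have hsum := sum_card_success_le hℓ e he C hC hd W T hBn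
  -- real form of the total bound
  set X : ℕ := ∑ v, ((C v).size + 2) with hX
  have htot : (∑ u ∈ T, ((univ.filter fun ρ : Fin r → Bool => S u ρ).card : ℝ)) ≤
      2 ^ r * (B + (X : ℝ) * 2 ^ k / (p : ℝ) ^ ℓ) := by
    rw [← Nat.cast_sum, hswap]
    have h' : ((∑ ρ : Fin r → Bool, (T.filter fun u => S u ρ).card : ℕ) : ℝ) * (p : ℝ) ^ ℓ ≤
        2 ^ r * ((⌊B⌋₊ : ℝ) * (p : ℝ) ^ ℓ + (X : ℝ) * 2 ^ k) := by exact_mod_cast hsum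
    rw [← le_div_iff₀ hpℓ] at h'
    refine h'.trans ?_
    rw [div_le_iff₀ hpℓ]
    have h2r : (0 : ℝ) ≤ 2 ^ r := by positivity
    calc 2 ^ r * ((⌊B⌋₊ : ℝ) * (p : ℝ) ^ ℓ + (X : ℝ) * 2 ^ k)
        ≤ 2 ^ r * (B * (p : ℝ) ^ ℓ + (X : ℝ) * 2 ^ k) := by
          refine mul_le_mul_of_nonneg_left ?_ h2r
          exact add_le_add (mul_le_mul_of_nonneg_right hfloor hpℓ.le) le_rfl
      _ = 2 ^ r * (B + (X : ℝ) * 2 ^ k / (p : ℝ) ^ ℓ) * (p : ℝ) ^ ℓ := by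
          field_simp
  -- pigeonhole over `T`
  have hTcard : (0 : ℝ) < T.card := by exact_mod_cast hT.card_pos
  obtain ⟨u, huT, hu⟩ : ∃ u ∈ T, ((univ.filter fun ρ : Fin r → Bool => S u ρ).card : ℝ) ≤
      2 ^ r * (B + (X : ℝ) * 2 ^ k / (p : ℝ) ^ ℓ) / T.card := by
    refine exists_le_of_sum_le hT ?_
    rw [sum_const, nsmul_eq_mul, mul_div_cancel₀ _ hTcard.ne']
    exact htot
  refine ⟨u, huT, ?_⟩
  rw [uniformProb_eq_card (S u), div_le_iff₀ (by positivity : (0 : ℝ) < 2 ^ r)]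
  calc ((univ.filter fun f : Fin r → Bool => S u f).card : ℝ)
      ≤ 2 ^ r * (B + (X : ℝ) * 2 ^ k / (p : ℝ) ^ ℓ) / T.card := hu
    _ = (B + (X : ℝ) * 2 ^ k / (p : ℝ) ^ ℓ) / T.card * 2 ^ r := by ring
    _ = (B + (∑ v, ((C v).size + 2 : ℝ)) * 2 ^ k / (p : ℝ) ^ ℓ) / T.card * 2 ^ r := by
        rw [hX]; push_cast; rfl

/-- **Razborov–Smolensky for relation problems against `AC⁰[p]/rpoly` (probability form, all
parameters promised).** As `exists_mem_uniformProb_le` with `T = {0,1}ᵏ`: some parameter `u` has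
success probability at most `B/2ᵏ + (Σ_v (size C_v + 2))/p^ℓ`.
[cite: WattsEtAl2019, proof of Theorem 15] -/
theorem exists_uniformProb_le {k n r m d ℓ : ℕ} (hℓ : 1 ≤ ℓ)
    (e : (Fin k → Bool) → (Fin n → Bool))
    (he : ∀ i, (∃ b, ∀ u, e u i = b) ∨ (∃ j, ∀ u, e u i = u j))
    (C : Fin m → Circuit (Fin (n + r))) (hC : ∀ v, (C v).IsOver (accBasis p))
    (hd : ∀ v, (C v).acDepth ≤ d) (W : (Fin k → Bool) → (Fin m → Bool) → Prop) {B : ℝ}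
    (hB : ∀ P : Fin m → CubeFn (ZMod p) k,
      (∀ v, P v ∈ lowDeg (ZMod p) k (((p - 1) * ℓ) ^ (d + 1))) →
        ((univ.filter fun u => W u fun v => decide (P v u = 1)).card : ℝ) ≤ B) :
    ∃ u : Fin k → Bool,
      uniformProb r {ρ | W u fun v => (C v).eval (Fin.append (e u) fun i => ρ.getD i false)} ≤
        B / 2 ^ k + (∑ v, ((C v).size + 2 : ℝ)) / (p : ℝ) ^ ℓ := by
  have hp := (Fact.out : p.Prime)
  have hpℓ : (0 : ℝ) < (p : ℝ) ^ ℓ := by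
    have : (0 : ℝ) < p := by exact_mod_cast hp.pos
    positivity
  obtain ⟨u, -, hu⟩ := exists_mem_uniformProb_le hℓ e he C hC hd W
    (univ_nonempty : (univ : Finset (Fin k → Bool)).Nonempty) hB
  refine ⟨u, hu.trans (le_of_eq ?_)⟩
  rw [card_univ, Fintype.card_fun, Fintype.card_bool, Fintype.card_fin]
  push_cast
  field_simp

end Smolensky

end Literature.Computability.MetaComplexity
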